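import Mathlib
import Summits.KontsevichZagierPeriods.Zeta5Search.BrickHoleConst

/-!
# BrickHoleConstExact — zi-p2's THEOREM 10 LEMMA 10.2 (a), the EXACT valuation of the hole multiplier:
`v_p(a) = A + B|ε| + c + (A−2B)·v_p(N')` (tree normalisation `a = N'^{A−2B}Λ_K`; cell zeta5-irr)

HONEST FRAMING: systematic search; no irrationality claim unless certified. INSTRUMENT lemma of the ζ(5)
census cell zeta5-irr (HOME `run/shared/lean/pub/zeta5-irr/`; memo `zi-p2/probes/B8/thm10/THEOREM10.md` (sealed
eeb9a92811d678e0) LEMMA 10.2 / (i): «Λ_K = p^{A+B|ε|+c}·Λ°_K, Λ°_K = (−1)^{B(N₀+ε₁)}·θ_K·Ξ_K ∈ ℤ_(p)^× (so v(Λ_K) =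
A + B|ε| + c EXACTLY)», listed by zi-ref R6.31 ADDENDUM-2 as one of the three memo-only remainders of the THEOREM 10
record). The tree's `BrickHoleConst.padicValuation_holeConst_le` records only `v(a) ≤ exp(−A)`; this file proves the
EQUALITY, from the same closed form `BrickHoleConst.holeConst_closed`. Nothing here is about ζ(5); no irrationality
content; filing moves no rung. Filed by the engine seat zi-eng (g11).

## The statement (digits `i + i' = n₀ + p`, `i, i' < p`, `n₀ < p`; blocks `J + M = m`, `N' = m+1`; `n = n₀ + N'p`,
`k = i + Jp`; class carries `ε₁ = (n₀+i)/p`, `ε₂ = (n₀+i')/p ∈ {0,1}`, `|ε| = ε₁ + ε₂`; centre carry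
`c = centreCarry p n k = [p ∣ n − 2k]`)

* `val_aux_eq` — the abstract valuation bookkeeping (equality version of `BrickHoleConst.val_aux`);
* **`padicValuation_holeConst_eq`**: for `a·holePoly(0)·c̃_{J,A}(m) = c_{k,A}(n)`, `p` odd, `2B ≤ A`, `ε ≤ 1` and off the
  exact centre (`2k ≠ n ∨ ε = 0`):
  `v(a) = exp(−A)·exp(−1)^{ε₁B}·exp(−1)^{ε₂B}·exp(−1)^{εc}·v(N')^{A−2B}`, i.e.
  **`v_p(a) = A + B|ε| + εc + (A−2B)v_p(N')`** — zi-p2's `v(Λ_K) = A + B|ε| + c` for `Λ_K = a/N'^{A−2B}` (`ε = 1`).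
-/

namespace Summit.KontsevichZagierPeriods.Zeta5Search.BrickHoleConstExact

open Finset Nat Polynomial WithZero
open Summit.KontsevichZagierPeriods.Zeta5Search.BrickTopCoefficient (cTop)
open Summit.KontsevichZagierPeriods.Zeta5Search.BrickLambda (padicValuation_two)
open Summit.KontsevichZagierPeriods.Zeta5Search.BrickLambdaCirc (padicValuation_centre_eq_one)
open Summit.KontsevichZagierPeriods.Zeta5Search.BrickDigitStripCirc (centreCarry centreCarry_le_one)
open Summit.KontsevichZagierPeriods.Zeta5Search.BrickHoleStrip (holePoly)
open Summit.KontsevichZagierPeriods.Zeta5Search.BrickHoleMultiplier (padicValuation_holeUnitPart)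
open Summit.KontsevichZagierPeriods.Zeta5Search.BrickHoleConst (holeConst_closed padicValuation_classPoly_eval_zero
  padicValuation_holeGainPart)

variable {p : ℕ} [Fact p.Prime]

/-- The valuation bookkeeping, EQUALITY version (abstract values in `ℤᵐ⁰`): from
`va·(v1^{e₁B} v2^{e₂B} vy^k)·vn^{2B} = vc^ε·(exp(−A) vn^A)·(exp(−1)^{e₁B}v1^{e₁B}·(exp(−1)^{e₂B}v2^{e₂B}))` with `v1, v2, vn ≠ 0`,
`2B ≤ A`, and either (`k = 0`, `vc^ε = 1`) or (`k = 1`, `ε = 1`, `vy = vc·exp(1)`, `vc ≠ 0`):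
`va = exp(−A)·exp(−1)^{e₁B}·exp(−1)^{e₂B}·exp(−1)^k·vn^{A−2B}`. -/
theorem val_aux_eq {va vc vy vn v1 v2 : WithZero (Multiplicative ℤ)} {A' B' ε' e₁ e₂ k : ℕ} (hAB' : 2 * B' ≤ A')
    (h : va * (v1 ^ (e₁ * B') * v2 ^ (e₂ * B') * vy ^ k) * vn ^ (2 * B') =
      vc ^ ε' * (exp (-(A' : ℤ)) * vn ^ A') * (exp (-1 : ℤ) ^ (e₁ * B') * v1 ^ (e₁ * B') *
        (exp (-1 : ℤ) ^ (e₂ * B') * v2 ^ (e₂ * B'))))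
    (hv1 : v1 ≠ 0) (hv2 : v2 ≠ 0) (hvn0 : vn ≠ 0)
    (hk : (k = 0 ∧ vc ^ ε' = 1) ∨ (k = 1 ∧ ε' = 1 ∧ vy = vc * exp (1 : ℤ) ∧ vc ≠ 0)) :
    va = exp (-(A' : ℤ)) * exp (-1 : ℤ) ^ (e₁ * B') * exp (-1 : ℤ) ^ (e₂ * B') * exp (-1 : ℤ) ^ k *
      vn ^ (A' - 2 * B') := by
  have hX : v1 ^ (e₁ * B') * v2 ^ (e₂ * B') * vn ^ (2 * B') ≠ 0 :=
    mul_ne_zero (mul_ne_zero (pow_ne_zero _ hv1) (pow_ne_zero _ hv2)) (pow_ne_zero _ hvn0)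
  have hA : vn ^ A' = vn ^ (A' - 2 * B') * vn ^ (2 * B') := by rw [← pow_add, Nat.sub_add_cancel hAB']
  rw [hA] at h
  -- isolate `va·vy^k·vc⁻… ` : both sides carry the factor `X = v1^{e₁B}v2^{e₂B}vn^{2B}`
  have h2 : va * vy ^ k * (v1 ^ (e₁ * B') * v2 ^ (e₂ * B') * vn ^ (2 * B')) =
      vc ^ ε' * (exp (-(A' : ℤ)) * exp (-1 : ℤ) ^ (e₁ * B') * exp (-1 : ℤ) ^ (e₂ * B') * vn ^ (A' - 2 * B')) *
        (v1 ^ (e₁ * B') * v2 ^ (e₂ * B') * vn ^ (2 * B')) := by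
    calc _ = va * (v1 ^ (e₁ * B') * v2 ^ (e₂ * B') * vy ^ k) * vn ^ (2 * B') := by
          simp only [mul_assoc, mul_comm]
      _ = _ := h
      _ = _ := by simp only [mul_assoc, mul_comm, mul_left_comm]
  have h3 := mul_right_cancel₀ hX h2
  rcases hk with ⟨h0, hc⟩ | ⟨h1, hε1, hvy', hvc0⟩
  · rw [h0, pow_zero, mul_one, hc, one_mul] at h3
    rw [h3, h0, pow_zero, mul_one]
  · subst h1; subst hε1
    rw [pow_one, hvy', pow_one] at h3
    have h4 : va * exp (1 : ℤ) * vc =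
        (exp (-(A' : ℤ)) * exp (-1 : ℤ) ^ (e₁ * B') * exp (-1 : ℤ) ^ (e₂ * B') * vn ^ (A' - 2 * B')) * vc := by
      calc _ = va * (vc * exp (1 : ℤ)) := by simp only [mul_comm, mul_left_comm]
        _ = _ := h3
        _ = _ := by simp only [mul_assoc, mul_comm]
    have h5 := mul_right_cancel₀ hvc0 h4
    have he : exp (1 : ℤ) * exp (-1 : ℤ) = 1 := by rw [← exp_add]; norm_num
    calc va = va * exp (1 : ℤ) * exp (-1 : ℤ) := by rw [mul_assoc, he, mul_one]
      _ = _ := by rw [h5, pow_one]; simp only [mul_assoc, mul_comm, mul_left_comm]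

section const

variable (hp2 : p ≠ 2) {A B ε n₀ i i' J M : ℕ} (hAB : 2 * B ≤ A) (hε : ε ≤ 1) (hii : i + i' = n₀ + p)
  (hi : i < p) (hi' : i' < p) (hn₀ : n₀ < p)
include hp2 hAB hε hii hi hi' hn₀

/-- **THE EXACT VALUATION OF THE HOLE CONSTANT** (zi-p2's LEMMA 10.2 «v(Λ_K) = A + B|ε| + c EXACTLY», tree normalisation):
for `a·holePoly(0)·c̃_{J,A}(m) = c_{k,A}(n)` and off the exact centre (`2k ≠ n ∨ ε = 0`),
`v(a) = exp(−A)·exp(−1)^{ε₁B}·exp(−1)^{ε₂B}·exp(−1)^{ε·c}·v(N')^{A−2B}` with `ε₁ = (n₀+i)/p`, `ε₂ = (n₀+i')/p`,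
`c = centreCarry p n k`, `N' = J+M+1` — i.e. `v_p(a) = A + B(ε₁+ε₂) + εc + (A−2B)v_p(N')`. -/
theorem padicValuation_holeConst_eq {a : ℚ}
    (ha : a * (holePoly B ε p n₀ (J + M) i J).eval 0 * cTop A B 0 (J + M) J = cTop A B ε (n₀ + (J + M + 1) * p) (i + J * p))
    (hcen : 2 * (i + J * p) ≠ n₀ + (J + M + 1) * p ∨ ε = 0) :
    Rat.padicValuation p a = exp (-(A : ℤ)) * exp (-1 : ℤ) ^ ((n₀ + i) / p * B) * exp (-1 : ℤ) ^ ((n₀ + i') / p * B) *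
      exp (-1 : ℤ) ^ (ε * centreCarry p (n₀ + (J + M + 1) * p) (i + J * p)) *
      Rat.padicValuation p (((J + M + 1 : ℕ) : ℚ)) ^ (A - 2 * B) := by
  have hp : p.Prime := Fact.out
  have hpQ : (p : ℚ) ≠ 0 := by exact_mod_cast hp.ne_zero
  have hnQ : (((J + M + 1 : ℕ) : ℚ)) ≠ 0 := by positivity
  have hi'eq : n₀ + (n₀ + p - i) = n₀ + i' := by omega
  have h := congrArg (Rat.padicValuation p) (holeConst_closed (p := p) (A := A) (B := B) (ε := ε) hii hi hi' hn₀ ha)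
  simp only [map_mul, map_pow, Valuation.map_neg, map_one, one_pow, mul_one, one_mul, padicValuation_holeUnitPart,
    Rat.padicValuation_self, padicValuation_classPoly_eval_zero, padicValuation_holeGainPart, hi'eq] at h
  rw [← exp_nsmul, nsmul_eq_mul, mul_neg_one] at h
  rw [mul_comm B ((n₀ + i) / p), mul_comm B ((n₀ + i') / p), mul_pow, mul_pow] at h
  have hv1 : Rat.padicValuation p (((J + M + 1 + J + 1 : ℕ) : ℚ)) ≠ 0 := (Valuation.ne_zero_iff _).2 (by positivity)
  have hv2 : Rat.padicValuation p (((J + M + 1 + M + 1 : ℕ) : ℚ)) ≠ 0 := (Valuation.ne_zero_iff _).2 (by positivity)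
  have hvn0 : Rat.padicValuation p (((J + M + 1 : ℕ) : ℚ)) ≠ 0 := (Valuation.ne_zero_iff _).2 hnQ
  -- the centre class: either no centre factor surviving (`k = 0`, and then `v(n/2 − k)^ε = 1`), or the carry case
  have hk : (ε * centreCarry p (n₀ + (J + M + 1) * p) (i + J * p) = 0 ∧
        Rat.padicValuation p ((((n₀ + (J + M + 1) * p : ℕ) : ℚ)) / 2 - ((i + J * p : ℕ) : ℚ)) ^ ε = 1) ∨
      (ε * centreCarry p (n₀ + (J + M + 1) * p) (i + J * p) = 1 ∧ ε = 1 ∧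
        Rat.padicValuation p (((((n₀ + (J + M + 1) * p : ℕ) : ℚ)) / 2 - ((i + J * p : ℕ) : ℚ)) / p) =
          Rat.padicValuation p ((((n₀ + (J + M + 1) * p : ℕ) : ℚ)) / 2 - ((i + J * p : ℕ) : ℚ)) * exp (1 : ℤ) ∧
        Rat.padicValuation p ((((n₀ + (J + M + 1) * p : ℕ) : ℚ)) / 2 - ((i + J * p : ℕ) : ℚ)) ≠ 0) := by
    rcases Nat.le_one_iff_eq_zero_or_eq_one.1 hε with h0 | h1
    · left; rw [h0, zero_mul, pow_zero]; exact ⟨rfl, rfl⟩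
    · subst h1
      by_cases hdvd : (p : ℤ) ∣ ((n₀ + (J + M + 1) * p : ℕ) : ℤ) - 2 * ((i + J * p : ℕ) : ℤ)
      · right
        have c1 : centreCarry p (n₀ + (J + M + 1) * p) (i + J * p) = 1 := by
          unfold centreCarry; rw [if_pos hdvd]
        have hc2 : 2 * (i + J * p) ≠ n₀ + (J + M + 1) * p := by
          rcases hcen with h | h
          · exact h
          · exact absurd h one_ne_zero
        have hc0 : (((n₀ + (J + M + 1) * p : ℕ) : ℚ)) / 2 - ((i + J * p : ℕ) : ℚ) ≠ 0 := by
          intro h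
          have : (((n₀ + (J + M + 1) * p : ℕ) : ℚ)) = 2 * ((i + J * p : ℕ) : ℚ) := by linarith
          exact hc2 (by exact_mod_cast this.symm)
        refine ⟨by rw [c1], rfl, ?_, (Valuation.ne_zero_iff _).2 hc0⟩
        rw [map_div₀, Rat.padicValuation_self, div_eq_mul_inv, ← exp_neg, neg_neg]
      · left
        have c0 : centreCarry p (n₀ + (J + M + 1) * p) (i + J * p) = 0 := by
          unfold centreCarry; rw [if_neg hdvd]
        rw [c0, mul_zero, pow_one]
        exact ⟨rfl, padicValuation_centre_eq_one hp2 hdvd⟩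
  rcases hk with ⟨hk0, hc⟩ | ⟨hk1, hε1, hvy, hvc0⟩
  · have := val_aux_eq hAB h hv1 hv2 hvn0 (Or.inl ⟨hk0, hc⟩)
    rw [this, hk0]
  · have := val_aux_eq hAB h hv1 hv2 hvn0 (Or.inr ⟨hk1, hε1, hvy, hvc0⟩)
    rw [this, hk1]

/-- The same in zi-p2's additive form: **`v_p(a) = A + B(ε₁+ε₂) + ε·c + (A−2B)·v_p(N')`**, written as
`v(a) = exp(−(A + B(ε₁+ε₂) + εc))·v(N')^{A−2B}`. -/
theorem padicValuation_holeConst_eq' {a : ℚ}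
    (ha : a * (holePoly B ε p n₀ (J + M) i J).eval 0 * cTop A B 0 (J + M) J = cTop A B ε (n₀ + (J + M + 1) * p) (i + J * p))
    (hcen : 2 * (i + J * p) ≠ n₀ + (J + M + 1) * p ∨ ε = 0) :
    Rat.padicValuation p a =
      exp (-((A + B * ((n₀ + i) / p + (n₀ + i') / p) + ε * centreCarry p (n₀ + (J + M + 1) * p) (i + J * p) : ℕ) : ℤ)) *
        Rat.padicValuation p (((J + M + 1 : ℕ) : ℚ)) ^ (A - 2 * B) := by
  rw [padicValuation_holeConst_eq hp2 hAB hε hii hi hi' hn₀ ha hcen, ← exp_nsmul, ← exp_nsmul, ← exp_nsmul, ← exp_add,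
    ← exp_add, ← exp_add]
  congr 2
  simp only [Nat.cast_add, Nat.cast_mul]
  ring

end const

end Summit.KontsevichZagierPeriods.Zeta5Search.BrickHoleConstExact
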